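import Summits.MatrixMultiplication.MatrixMultiplication.Theorems.AbelianSTPPCensusTAStatFDefs

/-!
# T_A static certificate, range `6780 … 6833` (t*-indexed linear checker with the k-member tree at `τ = 2371/1000`): kernel evaluation, the shape checks (one-member cover, else the k-member tree), volumes `3765 … 3839`, all orders `6780 … 6833`

Cell mm-stpp (rung F-M1), tier T_A = «beat `2.371`, the record exponent (ADVXXZ'25 / DEK+26 rounded)»; checker in `AbelianSTPPCensusTAStatFDefs.lean`, table and bucket lists in `AbelianSTPPCensusTAStatFData.lean`
(pattern: theory g12's `AbelianSTPPCensusTAStatDDom*/DCk*.lean`).  `decide` with kernel reduction (standard axioms; no `native_decide`), `Elab.async false`;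
consumed by `TAStatF.checkV_sound` / `TAStatF.domV_sound` / `TAStatF.m2V_sound` in the leaf `AbelianSTPPCensusLeafTA6833Closed.lean`.
WHAT THIS IS NOT: arithmetic on shape lists only; no statement about STPP families or `ω`.
-/

set_option linter.dupNamespace false
set_option autoImplicit false
set_option Elab.async false

namespace Summit.MatrixMultiplication.MatrixMultiplication.Theorems.TAStatF

set_option maxHeartbeats 0 in
/-- Check chunk: every sorted candidate shape of the volumes `3765 … 3779` passes `checkShape` on the full order range (cost units 13026: (shape, bucket) cells and tree nodes). [original] -/
theorem ck3765 : TAStatF.checkV 6780 6833 15 3765 = true := by decide +kernel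

set_option maxHeartbeats 0 in
/-- Check chunk: every sorted candidate shape of the volumes `3781 … 3807` passes `checkShape` on the full order range (cost units 25527: (shape, bucket) cells and tree nodes). [original] -/
theorem ck3781 : TAStatF.checkV 6780 6833 27 3781 = true := by decide +kernel

set_option maxHeartbeats 0 in
/-- Check chunk: every sorted candidate shape of the volumes `3809 … 3821` passes `checkShape` on the full order range (cost units 11568: (shape, bucket) cells and tree nodes). [original] -/
theorem ck3809 : TAStatF.checkV 6780 6833 13 3809 = true := by decide +kernel

set_option maxHeartbeats 0 in
/-- Check chunk: every sorted candidate shape of the volumes `3823 … 3824` passes `checkShape` on the full order range (cost units 1506: (shape, bucket) cells and tree nodes). [original] -/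
theorem ck3823 : TAStatF.checkV 6780 6833 2 3823 = true := by decide +kernel

set_option maxHeartbeats 0 in
/-- Check chunk: every sorted candidate shape of the volumes `3826 … 3839` passes `checkShape` on the full order range (cost units 11727: (shape, bucket) cells and tree nodes). [original] -/
theorem ck3826 : TAStatF.checkV 6780 6833 14 3826 = true := by decide +kernel

end Summit.MatrixMultiplication.MatrixMultiplication.Theorems.TAStatF
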